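import Literature.AlgebraicGeometry.ShimuraVarieties.UnitaryBallSpecialDiscAction
import HarnessLib

/-!
# At injective level the special curve `Γ_W∖𝔹_W` is compact and immersed in `S(Γ)` as a closed submanifold

Topic `AlgebraicGeometry/ShimuraVarieties`; namespace
`Literature.AlgebraicGeometry.ShimuraVarieties.UnitaryBallUniformisationDatum`.  Sequel of
`UnitaryBallSpecialDiscAction`.  PROVED here, for `D : UnitaryBallUniformisationDatum 2 X`, a frame `𝔣`,
`s : D.DiscVec 𝔣`, `W = E·s`, under the injectivity hypothesis of the level
`hinj : ∀ γ ∈ Γ, (∃ z ∈ 𝔹_W, γ z ∈ 𝔹_W) → γ ∈ Γ_W` (no CM self-intersection of the immersed special curve;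
[Deligne 1971, Prop. 1.15] for `U(W^⊥) ↪ U(V)` at small level):

* `isClosedMap_specialCurveMap` — `Γ_W∖𝔹_W → S(Γ)` is a CLOSED map: near any point of `𝔹²` only finitely
  many `Γ`-translates of `𝔹_W` appear (`finite_specialBall_translates_submodule`, Kudla–Millson's «`j₁` is
  proper»), and by `hinj` two translates meeting in a point of `𝔹_W` coincide, so the saturation `Γ·C` of a closed
  `Γ_W`-stable `C ⊆ 𝔹_W` is locally a finite union of closed translates `γⱼ·C`;
* `isClosedEmbedding_specialCurveMap`, `compactSpace_specialCurve` — hence a closed embedding, and `Γ_W∖𝔹_W` is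
  COMPACT (closed in the compact `S(Γ)`, `UnitaryBallQuotientSurface`), WITHOUT any cocompactness input for `Γ_W`;
* `injective_mfderiv_specialCurveMap` — its differential is everywhere injective (through the local
  biholomorphisms `𝔹_W → Γ_W∖𝔹_W`, `𝔹² → S(Γ)` it is the inclusion `𝔹_W ⊆ 𝔹²`, a restriction of the chart).

So at injective level the special curve `C_W ⊆ S(Γ)` is analytified by a compact connected complex `1`-manifold
injectively immersed in `S(Γ)` — the input of `ProjectiveManifold.isSmoothProjective_of_isAnalytification`
(Serre GAGA §2 n°6) for the algebraisation of `C_W` as a SMOOTH projective closed subscheme.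

References: S. Kudla, J. Millson, Publ. Math. IHÉS 71 (1990), Lemma 1.1 p. 128 («`j₁` is a proper
embedding onto a totally geodesic submanifold»); N. Bergeron, J. Millson, C. Moeglin, Acta Math. 216
(2016), Introduction §§1.1, 1.7, Part 2 §§1.3, 3.1–3.3; W. Rudin, *Function Theory in the Unit Ball of ℂⁿ*
(1980), §2.2; P. Deligne, *Travaux de Shimura*, Sém. Bourbaki 389 (1971), Prop. 1.15; J. M. Lee,
*Introduction to Smooth Manifolds*, 2nd ed., Thm. 21.13.
Written for the cell `hodgecm-mathlib` (road (ii) «embedded-curve descent», census `CENSUS-GS3-of-Mumford`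
§4 R2-2 / `CENSUS-R2-2-Q2`): the manifold-level input of the algebraisation of special CURVES as smooth
projective closed subschemes (Serre GAGA §2 n°6 via the tree's `ProjectiveManifold.isSmoothProjective_of_isAnalytification`).
HC_CM is proved only modulo the 7 printed citations until rung 0 closes; nothing here is in a registered cone.
-/

set_option autoImplicit false

noncomputable section

open scoped Manifold ContDiff Topology
open Matrix Complex ComplexConjugate Set Function MulAction
open Literature.Geometry.ComplexHyperbolic
open Literature.Geometry.ComplexHyperbolic.BallModel

namespace Literature.AlgebraicGeometry.ShimuraVarieties

namespace UnitaryBallUniformisationDatum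

open Literature.AlgebraicGeometry.Motives (SchemeOver ComplexPoints)

variable {X₂ : SchemeOver ℂ} (D : UnitaryBallUniformisationDatum 2 X₂) (𝔣 : D.SylvesterFrame)

section CurveClosed

variable (s : D.DiscVec 𝔣)

/-- **Closedness at injective level**: under the same hypothesis, `Γ_W∖𝔹_W → S(Γ)` is a closed map
(local finiteness of the `Γ`-translates of `𝔹_W`, `finite_specialBall_translates_submodule`: near any point
of `𝔹²` the saturation `Γ·C` of a closed `Γ_W`-stable `C ⊆ 𝔹_W` is a finite union of translates `γⱼ C`).
[cite: KudlaMillson1990, Lemma 1.1, p. 128] -/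
theorem isClosedMap_specialCurveMap
    (hinj : ∀ γ : D.Γ, (∃ z ∈ D.specialBall 𝔣 {s.1}, D.ballRep 𝔣 γ • z ∈ D.specialBall 𝔣 {s.1}) →
      γ ∈ D.lineStab (D.E ∙ s.1)) :
    IsClosedMap (D.specialCurveMap 𝔣 s) := by
  intro C hC
  -- the lift `C̃ ⊆ 𝔹_W ⊆ 𝔹²` of `C`, a closed `Γ_W`-stable subset of the ball
  set C' : Set Ball := (fun z : D.specialDisc 𝔣 s ↦ z.1) '' (D.specialCurveMk 𝔣 s ⁻¹' C) with hC'
  have hC'closed : IsClosed C' :=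
    (D.isClosed_specialBall 𝔣 {s.1}).isClosedEmbedding_subtypeVal.isClosedMap _
      (hC.preimage continuous_quotient_mk')
  have hC'sub : C' ⊆ D.specialBall 𝔣 {s.1} := by
    rintro _ ⟨z, -, rfl⟩
    exact z.2
  have hC'stab : ∀ γ : D.Γ, γ ∈ D.lineStab (D.E ∙ s.1) → ∀ c ∈ C', D.ballRep 𝔣 γ • c ∈ C' := by
    rintro γ hγ _ ⟨z, hz, rfl⟩
    refine ⟨(⟨γ, hγ⟩ : D.lineStab (D.E ∙ s.1)) • z, ?_, rfl⟩
    have hmk : D.specialCurveMk 𝔣 s ((⟨γ, hγ⟩ : D.lineStab (D.E ∙ s.1)) • z) = D.specialCurveMk 𝔣 s z :=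
      Literature.Geometry.Manifold.QuotientManifold.mk_smul _ _
    change D.specialCurveMk 𝔣 s (_ • z) ∈ C
    rw [hmk]
    exact hz
  -- the preimage of the image under the projection `𝔹² → S(Γ)` is the saturation `Γ · C'`
  set P : Set Ball := D.quotientSurfaceMk 𝔣 ⁻¹' (D.specialCurveMap 𝔣 s '' C) with hP
  have hPiff : ∀ w : Ball, w ∈ P ↔ ∃ γ : D.Γ, ∃ c ∈ C', D.ballRep 𝔣 γ • c = w := by
    intro w
    constructor
    · rintro ⟨q, hq, hqw⟩
      obtain ⟨z, rfl⟩ := Quotient.mk_surjective (s := orbitRel _ _) q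
      change D.quotientSurfaceMk 𝔣 z.1 = D.quotientSurfaceMk 𝔣 w at hqw
      obtain ⟨γ, hγ⟩ := (D.quotientSurfaceMk_eq_iff 𝔣 _ _).1 hqw.symm
      exact ⟨γ, z.1, ⟨z, hq, rfl⟩, hγ⟩
    · rintro ⟨γ, c, ⟨z, hz, rfl⟩, rfl⟩
      refine ⟨D.specialCurveMk 𝔣 s z, hz, ?_⟩
      rw [specialCurveMap_mk]
      exact (D.quotientSurfaceMk_eq_iff 𝔣 _ _).2 ⟨γ⁻¹, by rw [map_inv, inv_smul_smul]⟩
  -- it suffices that `P` is closed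
  suffices hPclosed : IsClosed P by
    exact (Literature.Geometry.Manifold.QuotientManifold.isQuotientCoveringMap_mk
      (G := D.ballImage 𝔣) (M := Ball)).toIsQuotientMap.isClosed_preimage.1 hPclosed
  -- local finiteness: near each point only finitely many translates of `𝔹_W` appear
  rw [← closure_subset_iff_isClosed]
  intro w hw
  obtain ⟨K, hK, hKw⟩ := exists_compact_mem_nhds w
  have hfin := D.finite_specialBall_translates_submodule 𝔣 (D.E ∙ s.1) hK
  -- representatives of the finitely many translates meeting `K`
  set T : Set (Set Ball) := {B : Set Ball | (∃ γ : D.Γ,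
      D.specialBall 𝔣 (D.vact γ '' ((D.E ∙ s.1 : Submodule D.E (Fin 3 → D.E)) : Set (Fin 3 → D.E))) = B) ∧
      (B ∩ K).Nonempty} with hT
  have hrep : ∀ B ∈ T, ∃ γ : D.Γ,
      D.specialBall 𝔣 (D.vact γ '' ((D.E ∙ s.1 : Submodule D.E (Fin 3 → D.E)) : Set (Fin 3 → D.E))) = B :=
    fun B hB ↦ hB.1
  choose! γrep hγrep using hrep
  -- `P ∩ K` is contained in the finite union of the closed sets `γ_B · C'`
  have hPK : P ∩ K ⊆ ⋃ B ∈ T, (fun c ↦ D.ballRep 𝔣 (γrep B) • c) '' C' := by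
    rintro x ⟨hxP, hxK⟩
    obtain ⟨γ, c, hc, rfl⟩ := (hPiff x).1 hxP
    -- the translate `γ 𝔹_W` meets `K`, so it is one of the `B ∈ T`
    set B : Set Ball := D.specialBall 𝔣 (D.vact γ '' ((D.E ∙ s.1 : Submodule D.E (Fin 3 → D.E)) :
      Set (Fin 3 → D.E))) with hB
    have hcW : c ∈ D.specialBall 𝔣 ((D.E ∙ s.1 : Submodule D.E (Fin 3 → D.E)) : Set (Fin 3 → D.E)) := by
      rw [← D.specialBall_singleton_eq_span 𝔣 s.1]
      exact hC'sub hc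
    have hxB : D.ballRep 𝔣 γ • c ∈ B := (D.smul_mem_specialBall_iff 𝔣 γ _ c).2 hcW
    have hBT : B ∈ T := ⟨⟨γ, rfl⟩, ⟨_, hxB, hxK⟩⟩
    -- `δ := γ_B⁻¹ γ` moves the point `c` of `𝔹_W` into `𝔹_W`, hence stabilises `W`
    have hB' := hγrep B hBT
    set δ : D.Γ := (γrep B)⁻¹ * γ with hδ
    have hδc : D.ballRep 𝔣 δ • c ∈ D.specialBall 𝔣 {s.1} := by
      rw [hδ, map_mul, map_inv, mul_smul, D.specialBall_singleton_eq_span 𝔣 s.1,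
        ← D.smul_mem_specialBall_iff 𝔣 (γrep B), smul_inv_smul, hB']
      exact hxB
    have hδW : δ ∈ D.lineStab (D.E ∙ s.1) := hinj δ ⟨c, hC'sub hc, hδc⟩
    refine Set.mem_iUnion₂.2 ⟨B, hBT, D.ballRep 𝔣 δ • c, hC'stab δ hδW c hc, ?_⟩
    change D.ballRep 𝔣 (γrep B) • (D.ballRep 𝔣 ((γrep B)⁻¹ * γ) • c) = D.ballRep 𝔣 γ • c
    rw [map_mul, map_inv, mul_smul, smul_inv_smul]
  -- … which is contained in `P`
  have hUP : (⋃ B ∈ T, (fun c ↦ D.ballRep 𝔣 (γrep B) • c) '' C') ⊆ P := by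
    intro x hx
    obtain ⟨B, hBT, c, hc, rfl⟩ := Set.mem_iUnion₂.1 hx
    exact (hPiff _).2 ⟨γrep B, c, hc, rfl⟩
  -- and closed (finite union of closed sets)
  have hUclosed : IsClosed (⋃ B ∈ T, (fun c ↦ D.ballRep 𝔣 (γrep B) • c) '' C') :=
    hfin.isClosed_biUnion fun B _ ↦ (Homeomorph.smul (D.ballRep 𝔣 (γrep B))).isClosedMap _ hC'closed
  -- conclude: `w ∈ closure (P ∩ K) ⊆ ⋃ … ⊆ P`
  have hwPK : w ∈ closure (P ∩ K) := by
    rw [mem_closure_iff_nhds] at hw ⊢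
    intro U hU
    obtain ⟨y, hyU, hyP⟩ := hw (U ∩ K) (Filter.inter_mem hU hKw)
    exact ⟨y, hyU.1, hyP, hyU.2⟩
  exact hUP ((closure_minimal hPK hUclosed) hwPK)

/-- **At injective level `Γ_W∖𝔹_W → S(Γ)` is a closed embedding.** [cite: KudlaMillson1990, Lemma 1.1, p. 128] -/
theorem isClosedEmbedding_specialCurveMap
    (hinj : ∀ γ : D.Γ, (∃ z ∈ D.specialBall 𝔣 {s.1}, D.ballRep 𝔣 γ • z ∈ D.specialBall 𝔣 {s.1}) →
      γ ∈ D.lineStab (D.E ∙ s.1)) :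
    Topology.IsClosedEmbedding (D.specialCurveMap 𝔣 s) :=
  .of_continuous_injective_isClosedMap (D.contMDiff_specialCurveMap 𝔣 s).continuous
    (D.specialCurveMap_injective 𝔣 s hinj) (D.isClosedMap_specialCurveMap 𝔣 s hinj)

/-- **At injective level the special curve `Γ_W∖𝔹_W` is COMPACT** (closed-embedded in the compact `S(Γ)`).
[cite: KudlaMillson1990, Lemma 1.1, p. 128] [cite: BergeronMillsonMoeglin2016Balls, Introduction §1.1] -/
theorem compactSpace_specialCurve
    (hinj : ∀ γ : D.Γ, (∃ z ∈ D.specialBall 𝔣 {s.1}, D.ballRep 𝔣 γ • z ∈ D.specialBall 𝔣 {s.1}) →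
      γ ∈ D.lineStab (D.E ∙ s.1)) :
    CompactSpace (D.specialCurve 𝔣 s) :=
  (D.isClosedEmbedding_specialCurveMap 𝔣 s hinj).compactSpace

/-! ### §6 The differential of `Γ_W∖𝔹_W → S(Γ)` is injective -/

/-- The inclusion `𝔹_W → 𝔹²` has injective differential (it is a restriction of the chart). [cite: BergeronMillsonMoeglin2016Balls, Part 2 §3.3] -/
theorem injective_mfderiv_specialDisc_val (z : D.specialDisc 𝔣 s) :
    Injective (mfderiv 𝓘(ℂ, Fin 1 → ℂ) 𝓘(ℂ, Fin 2 → ℂ) (fun z : D.specialDisc 𝔣 s ↦ z.1) z) := by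
  -- `L ∘ val = discChart`, with `L : 𝔹² → ℂ¹` the affine coordinate
  set L : Ball → (Fin 1 → ℂ) := fun w _ ↦ D.discCoord 𝔣 s.1 w.1 with hL
  have hLd : MDifferentiableAt 𝓘(ℂ, Fin 2 → ℂ) 𝓘(ℂ, Fin 1 → ℂ) L z.1 := by
    have hLs : ContMDiff 𝓘(ℂ, Fin 2 → ℂ) 𝓘(ℂ, Fin 1 → ℂ) ω L :=
      ((contDiff_pi.2 fun _ ↦ D.contDiff_discCoord 𝔣 s.1).contMDiff).comp contMDiff_coe
    exact hLs.mdifferentiableAt (by simp)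
  have hvd : MDifferentiableAt 𝓘(ℂ, Fin 1 → ℂ) 𝓘(ℂ, Fin 2 → ℂ) (fun z : D.specialDisc 𝔣 s ↦ z.1) z :=
    (D.contMDiff_specialDisc_val 𝔣 s (n := ω)).mdifferentiableAt (by simp)
  have hcomp : mfderiv 𝓘(ℂ, Fin 1 → ℂ) 𝓘(ℂ, Fin 1 → ℂ) (D.discChart 𝔣 s) z =
      (mfderiv 𝓘(ℂ, Fin 2 → ℂ) 𝓘(ℂ, Fin 1 → ℂ) L z.1).comp
        (mfderiv 𝓘(ℂ, Fin 1 → ℂ) 𝓘(ℂ, Fin 2 → ℂ) (fun z : D.specialDisc 𝔣 s ↦ z.1) z) := by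
    have hfun : D.discChart 𝔣 s = L ∘ fun z : D.specialDisc 𝔣 s ↦ z.1 := rfl
    rw [hfun]
    exact mfderiv_comp z hLd hvd
  -- the chart has injective differential
  have hchart : Injective (mfderiv 𝓘(ℂ, Fin 1 → ℂ) 𝓘(ℂ, Fin 1 → ℂ) (D.discChart 𝔣 s) z) := by
    have h := (mdifferentiable_chart (I := 𝓘(ℂ, Fin 1 → ℂ)) z).mfderiv_injective
      (mem_chart_source (Fin 1 → ℂ) z)
    exact h
  rw [hcomp] at hchart
  intro u v huv
  apply hchart
  change (mfderiv 𝓘(ℂ, Fin 2 → ℂ) 𝓘(ℂ, Fin 1 → ℂ) L z.1)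
      ((mfderiv 𝓘(ℂ, Fin 1 → ℂ) 𝓘(ℂ, Fin 2 → ℂ) (fun z : D.specialDisc 𝔣 s ↦ z.1) z) u) =
    (mfderiv 𝓘(ℂ, Fin 2 → ℂ) 𝓘(ℂ, Fin 1 → ℂ) L z.1)
      ((mfderiv 𝓘(ℂ, Fin 1 → ℂ) 𝓘(ℂ, Fin 2 → ℂ) (fun z : D.specialDisc 𝔣 s ↦ z.1) z) v)
  rw [huv]

/-- **`Γ_W∖𝔹_W → S(Γ)` has injective differential** (an immersion): through the local biholomorphisms
`𝔹_W → Γ_W∖𝔹_W` and `𝔹² → S(Γ)` it is the inclusion `𝔹_W ⊆ 𝔹²`. [cite: KudlaMillson1990, Lemma 1.1, p. 128] -/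
theorem injective_mfderiv_specialCurveMap (q : D.specialCurve 𝔣 s) :
    Injective (mfderiv 𝓘(ℂ, Fin 1 → ℂ) 𝓘(ℂ, Fin 2 → ℂ) (D.specialCurveMap 𝔣 s) q) := by
  obtain ⟨z, rfl⟩ := Quotient.mk_surjective (s := orbitRel _ _) q
  change Injective (mfderiv 𝓘(ℂ, Fin 1 → ℂ) 𝓘(ℂ, Fin 2 → ℂ) (D.specialCurveMap 𝔣 s)
    (D.specialCurveMk 𝔣 s z))
  have hld := D.isLocalDiffeomorph_specialCurveMk 𝔣 s z
  have hmk : MDifferentiableAt 𝓘(ℂ, Fin 1 → ℂ) 𝓘(ℂ, Fin 1 → ℂ) (D.specialCurveMk 𝔣 s) z :=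
    hld.mdifferentiableAt (by simp)
  have hFd : MDifferentiableAt 𝓘(ℂ, Fin 1 → ℂ) 𝓘(ℂ, Fin 2 → ℂ) (D.specialCurveMap 𝔣 s)
      (D.specialCurveMk 𝔣 s z) :=
    (D.contMDiff_specialCurveMap 𝔣 s).mdifferentiableAt (by simp)
  -- the lift `𝔹_W → S(Γ)` has injective differential
  have hlift : Injective (mfderiv 𝓘(ℂ, Fin 1 → ℂ) 𝓘(ℂ, Fin 2 → ℂ)
      (fun z : D.specialDisc 𝔣 s ↦ D.quotientSurfaceMk 𝔣 z.1) z) := by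
    have hS := D.isLocalDiffeomorph_quotientSurfaceMk 𝔣 z.1
    have hSd : MDifferentiableAt 𝓘(ℂ, Fin 2 → ℂ) 𝓘(ℂ, Fin 2 → ℂ) (D.quotientSurfaceMk 𝔣) z.1 :=
      hS.mdifferentiableAt (by simp)
    have hvd : MDifferentiableAt 𝓘(ℂ, Fin 1 → ℂ) 𝓘(ℂ, Fin 2 → ℂ) (fun z : D.specialDisc 𝔣 s ↦ z.1) z :=
      (D.contMDiff_specialDisc_val 𝔣 s (n := ω)).mdifferentiableAt (by simp)
    rw [show (fun z : D.specialDisc 𝔣 s ↦ D.quotientSurfaceMk 𝔣 z.1) =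
      D.quotientSurfaceMk 𝔣 ∘ fun z : D.specialDisc 𝔣 s ↦ z.1 from rfl, mfderiv_comp z hSd hvd]
    exact (hS.mfderivToContinuousLinearEquiv (by simp)).injective.comp
      (D.injective_mfderiv_specialDisc_val 𝔣 s z)
  -- descend through the projection, whose differential is onto
  have hcomp : mfderiv 𝓘(ℂ, Fin 1 → ℂ) 𝓘(ℂ, Fin 2 → ℂ)
      (fun z : D.specialDisc 𝔣 s ↦ D.quotientSurfaceMk 𝔣 z.1) z =
      (mfderiv 𝓘(ℂ, Fin 1 → ℂ) 𝓘(ℂ, Fin 2 → ℂ) (D.specialCurveMap 𝔣 s) (D.specialCurveMk 𝔣 s z)).comp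
        (mfderiv 𝓘(ℂ, Fin 1 → ℂ) 𝓘(ℂ, Fin 1 → ℂ) (D.specialCurveMk 𝔣 s) z) := by
    rw [show (fun z : D.specialDisc 𝔣 s ↦ D.quotientSurfaceMk 𝔣 z.1) =
      D.specialCurveMap 𝔣 s ∘ D.specialCurveMk 𝔣 s from rfl]
    exact mfderiv_comp z hFd hmk
  set e := hld.mfderivToContinuousLinearEquiv (by simp) with he
  refine (injective_iff_map_eq_zero _).2 fun v hv ↦ ?_
  obtain ⟨u, rfl⟩ := e.surjective v
  have hu : mfderiv 𝓘(ℂ, Fin 1 → ℂ) 𝓘(ℂ, Fin 2 → ℂ)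
      (fun z : D.specialDisc 𝔣 s ↦ D.quotientSurfaceMk 𝔣 z.1) z u = 0 := by
    rw [hcomp]
    exact hv
  have hu0 : u = 0 := hlift (by rw [hu, map_zero])
  rw [hu0, map_zero]

end CurveClosed


end UnitaryBallUniformisationDatum

end Literature.AlgebraicGeometry.ShimuraVarieties

end
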